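import Summits.NavierStokesRegularity.NavierStokesRegularity.Theorems.TypeIIInviscidRelaxationAxisymSwirlRegularRadialMomentumCalculus
import Summits.NavierStokesRegularity.NavierStokesRegularity.Theorems.TypeIIInviscidRelaxationAxisymSwirlRegularSplitTightness
import Summits.NavierStokesRegularity.NavierStokesRegularity.Theorems.ScenarioCensusRowF5lgSlice
import Literature.Analysis.FluidPDE.DriftHeatLocalComparison
import Literature.Analysis.PDE.PoissonBall
import Summits.NavierStokesRegularity.NavierStokesRegularity.Theorems.SwirlHolderTowerFunnelDrift
import HarnessLib

/-!
# Elliptic slice lemma for the radial momentum: a one-sided bound on `x_h·Δu_h` near the axis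
# interpolates the radial gate quadratically towards the axis

Helper toward the crux `AxisymSwirlRegular` (stmt-NavierStokesRegularity-1964, route TypeIIInviscidRelaxation),
criterion side of the registered line `radial_inflow_split` (stub `stub_oneSidedRadialCriterion`, ⟨19059⟩).

For an axisymmetric `C²` field `v` the radial momentum `Φ = x₀v₀ + x₁v₁ = r u_r` satisfies
`ΔΦ − 2(∂₀v₀ + ∂₁v₁) = x₀(Δv)₀ + x₁(Δv)₁` (tree: `laplacian_radialMomentum`) and `DΦ(x)[x_h] = r²(∂₀v₀+∂₁v₁)`
(tree: `fderiv_radialMomentum_horizontal_of_isAxisymmetric`), i.e. `LΦ = x_h·Δv_h` for the Stokes operator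
`L = Δ − (2/r²) x_h·∇ = ∂_r² − (1/r)∂_r + ∂_z²` (for divergence-free `v`, `x_h·Δv_h = r ∂_z ω_θ`: the Biot–Savart
coupling `LΨ = −rω_θ` differentiated in `z`, `Φ = −∂_zΨ`).  Since `L r² = 0` and `L r⁴ = 8r²`, a one-sided bound
`x_h·Δv_h ≤ K r²` on the punctured tube `0 < r < ρ` makes `Φ + c r²/ρ² − (K/8) r⁴ + Kρ⁴/8` an `L`-supersolution,
`≥ 0` on the axis and on `r = ρ` whenever `Φ ≥ −c` there; a weak minimum principle on truncated tubes (barrier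
`ε(3ρ r + ‖x‖²)`, `L(3ρ r + ‖x‖²) = 2 − 3ρ/r < 0`; lids pushed to `|z| → ∞` by a slice bound `‖v‖ ≤ B`) gives:

* `tube_min_principle` — weak minimum principle on the compact truncated tube `{r ≤ ρ, |x₂| ≤ Z}` (strict sign of
  `ΔG` at interior off-axis critical points, so no drift term is needed);
* `radialMomentum_ge_quadratic_of_radialLaplacian_le` — **slice lemma**: `Φ(x) ≥ −c r²/ρ² − (K/8)(ρ⁴ − r⁴)`
  for `0 < r < ρ`: the lateral gate value `−c` is interpolated QUADRATICALLY towards the axis up to the defect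
  `Kρ⁴/8` (on `r ≤ ρ/2` the gate constant improves from `c` to `c/4 + Kρ⁴/8`).

Consumer (next file): with the off-axis bound as lateral value, one application gives the radial gate with
constant `< 2` near the axis, hence continuation by the `C < 2` criterion, from a one-sided bound on
`x_h·Δu_h = r∂_zω_θ` alone.  Pure calculus; nothing here proves `stub_oneSidedRadialCriterion`,
`AxisymSwirlRegular` or NavierStokesRegularity. [new]
-/

noncomputable section

set_option linter.dupNamespace false

open Set Filter Topology Real WithLp Metric
open Literature.Analysis.FluidPDE
open scoped InnerProductSpace RealInnerProductSpace Laplacian ContDiff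

namespace Summit.NavierStokesRegularity.NavierStokesRegularity.Theorems.RadialInflowEllipticGate

open Summit.NavierStokesRegularity.NavierStokesRegularity.Theorems
open Summit.NavierStokesRegularity.NavierStokesRegularity.Theorems.ScenarioCensus.LogGate
open Summit.NavierStokesRegularity.NavierStokesRegularity.Theorems.ScenarioCensus.LogGate.SliceCalc

/-! ## §1 A weak minimum principle on truncated axis tubes -/

/-- The axial coordinate is continuous. [folklore] -/
theorem continuous_axialCoord : Continuous fun x : EuclideanSpace ℝ (Fin 3) => x 2 :=
  (EuclideanSpace.proj (2 : Fin 3) : EuclideanSpace ℝ (Fin 3) →L[ℝ] ℝ).continuous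

/-- The closed truncated tube `{r ≤ ρ, |x₂| ≤ Z}` is compact. [folklore] -/
theorem isCompact_closedTube (ρ Z : ℝ) :
    IsCompact {x : EuclideanSpace ℝ (Fin 3) | cylRadius x ≤ ρ ∧ |x 2| ≤ Z} := by
  refine Metric.isCompact_of_isClosed_isBounded ?_ ?_
  · exact (isClosed_le continuous_cylRadius continuous_const).inter
      (isClosed_le (continuous_abs.comp continuous_axialCoord) continuous_const)
  · rw [isBounded_iff_forall_norm_le]
    refine ⟨|ρ| + |Z|, fun x hx => ?_⟩
    have h2 : cylRadius x ≤ |ρ| := hx.1.trans (le_abs_self ρ)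
    have h3 : |x 2| ≤ |Z| := hx.2.trans (le_abs_self Z)
    have h4 : ‖x‖ ^ 2 ≤ (|ρ| + |Z|) ^ 2 := by
      rw [SwirlHolderTower.norm_sq_eq_cylRadius_sq_add, ← sq_abs (x 2)]
      nlinarith [cylRadius_nonneg x, abs_nonneg (x 2), abs_nonneg ρ, abs_nonneg Z,
        mul_self_le_mul_self (cylRadius_nonneg x) h2, mul_self_le_mul_self (abs_nonneg _) h3]
    exact (pow_le_pow_iff_left₀ (norm_nonneg x) (by positivity) two_ne_zero).1 h4

/-- The open punctured truncated tube `{0 < r < ρ, |x₂| < Z}` is open. [folklore] -/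
theorem isOpen_puncturedTube (ρ Z : ℝ) :
    IsOpen {x : EuclideanSpace ℝ (Fin 3) | 0 < cylRadius x ∧ cylRadius x < ρ ∧ |x 2| < Z} := by
  refine (isOpen_lt continuous_const continuous_cylRadius).inter
    ((isOpen_lt continuous_cylRadius continuous_const).inter
      (isOpen_lt (continuous_abs.comp continuous_axialCoord) continuous_const))

/-- **Weak minimum principle on a truncated axis tube.** Let `0 < ρ`, `0 ≤ Z`, and let `G : ℝ³ → ℝ` be continuous,
`C²` at every point of the punctured open tube `{0 < r < ρ, |x₂| < Z}`, with `ΔG(x) < 0` at every such point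
where `DG(x) = 0`.  If `G ≥ 0` on the axis part, the lateral part `r = ρ` and the lids `|x₂| = Z` of the closed
tube `{r ≤ ρ, |x₂| ≤ Z}`, then `G ≥ 0` on the whole closed tube.  Proof: a negative minimum over the compact tube
would sit in the punctured open tube, where `DG = 0` and `ΔG ≥ 0`
(`laplacian_nonpos_of_isLocalMax_of_contDiffOn`). [folklore] -/
theorem tube_min_principle {G : EuclideanSpace ℝ (Fin 3) → ℝ} {ρ Z : ℝ} (hG : Continuous G)
    (h2 : ∀ x : EuclideanSpace ℝ (Fin 3), 0 < cylRadius x → cylRadius x < ρ → |x 2| < Z → ContDiffAt ℝ 2 G x)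
    (hcrit : ∀ x : EuclideanSpace ℝ (Fin 3), 0 < cylRadius x → cylRadius x < ρ → |x 2| < Z →
      fderiv ℝ G x = 0 → (Δ G) x < 0)
    (haxis : ∀ x : EuclideanSpace ℝ (Fin 3), cylRadius x = 0 → |x 2| ≤ Z → 0 ≤ G x)
    (hlat : ∀ x : EuclideanSpace ℝ (Fin 3), cylRadius x = ρ → |x 2| ≤ Z → 0 ≤ G x)
    (hlid : ∀ x : EuclideanSpace ℝ (Fin 3), cylRadius x ≤ ρ → |x 2| = Z → 0 ≤ G x) :
    ∀ x : EuclideanSpace ℝ (Fin 3), cylRadius x ≤ ρ → |x 2| ≤ Z → 0 ≤ G x := by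
  intro x₀ hx₀ρ hx₀Z
  by_contra hneg
  rw [not_le] at hneg
  set Kc : Set (EuclideanSpace ℝ (Fin 3)) := {x | cylRadius x ≤ ρ ∧ |x 2| ≤ Z} with hKc
  set Ω : Set (EuclideanSpace ℝ (Fin 3)) := {x | 0 < cylRadius x ∧ cylRadius x < ρ ∧ |x 2| < Z} with hΩ
  have hKcpt : IsCompact Kc := isCompact_closedTube ρ Z
  have hx₀K : x₀ ∈ Kc := ⟨hx₀ρ, hx₀Z⟩
  obtain ⟨xm, hxmK, hmin⟩ := hKcpt.exists_isMinOn ⟨x₀, hx₀K⟩ hG.continuousOn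
  have hGm : G xm < 0 := lt_of_le_of_lt (hmin hx₀K) hneg
  have hr0 : 0 < cylRadius xm := (cylRadius_nonneg xm).lt_of_ne fun h =>
    absurd (haxis xm h.symm hxmK.2) (not_le.2 hGm)
  have hrρ : cylRadius xm < ρ := hxmK.1.lt_of_ne fun h => absurd (hlat xm h hxmK.2) (not_le.2 hGm)
  have hzZ : |xm 2| < Z := hxmK.2.lt_of_ne fun h => absurd (hlid xm hxmK.1 h) (not_le.2 hGm)
  have hΩopen : IsOpen Ω := isOpen_puncturedTube ρ Z
  have hxmΩ : xm ∈ Ω := ⟨hr0, hrρ, hzZ⟩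
  have hΩK : Ω ⊆ Kc := fun x hx => ⟨hx.2.1.le, hx.2.2.le⟩
  have hloc : IsLocalMin G xm :=
    (hmin.on_subset hΩK).isLocalMin (hΩopen.mem_nhds hxmΩ)
  have hcritm : fderiv ℝ G xm = 0 := hloc.fderiv_eq_zero
  have hmax : IsLocalMax (fun y => -G y) xm := hloc.neg
  have hC : ContDiffOn ℝ 2 (fun y => -G y) Ω := fun y hy =>
    (h2 y hy.1 hy.2.1 hy.2.2).neg.contDiffWithinAt
  have hlap : (Δ (fun y => -G y)) xm ≤ 0 := laplacian_nonpos_of_isLocalMax_of_contDiffOn hΩopen hxmΩ hC hmax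
  have hneg' : (Δ (fun y => -G y)) xm = -(Δ G) xm := by
    have e : (fun y => -G y) = -G := rfl
    rw [e, InnerProductSpace.laplacian_neg]
    rfl
  have := hcrit xm hr0 hrρ hzZ hcritm
  rw [hneg'] at hlap
  linarith

/-! ## §2 The slice lemma -/

/-- **Quadratic interpolation of the radial gate towards the axis (slice lemma).** Let `v : ℝ³ → ℝ³` be `C²`,
axisymmetric and bounded (`‖v‖ ≤ B`), let `0 < ρ`, `0 ≤ c`, `0 ≤ K`, and suppose
* `x₀(Δv)₀(y) + x₁(Δv)₁(y) ≤ K · r(y)²` at every point `y` of the punctured tube `0 < r < ρ` (one-sided bound on the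
  horizontal-radial pairing of the Laplacian; for a divergence-free field this is `r ∂_z ω_θ ≤ K r²`), and
* the gate `y₀v₀ + y₁v₁ ≥ −c` on the cylinder `r = ρ`.
Then for every `x` with `0 < r(x) < ρ`: `x₀v₀(x) + x₁v₁(x) ≥ −c r²/ρ² − (K/8)(ρ⁴ − r⁴)`.
Proof: minimum principle (`tube_min_principle`) for
`G = Φ + g(r²) + ε(3ρ r + ‖y‖²)`, `g(σ) = cσ/ρ² − Kσ²/8 + Kρ⁴/8 − εσ`, on tubes `|y₂| ≤ Z`, `Z → ∞`, then `ε → 0`;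
at an off-axis critical point `DG[y_h] = 0` expresses the horizontal divergence through the barrier, and
`ΔG = y_h·Δv_h − K r² + ε(2 − 3ρ/r) < 0`. [new] -/
theorem radialMomentum_ge_quadratic_of_radialLaplacian_le
    {v : EuclideanSpace ℝ (Fin 3) → EuclideanSpace ℝ (Fin 3)} (hv : ContDiff ℝ 2 v) (hax : IsAxisymmetric v)
    {B ρ c K : ℝ} (hB : ∀ y, ‖v y‖ ≤ B) (hρ : 0 < ρ) (hc : 0 ≤ c) (hK : 0 ≤ K)
    (hlap : ∀ y : EuclideanSpace ℝ (Fin 3), 0 < cylRadius y → cylRadius y < ρ →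
      y 0 * (Δ v) y 0 + y 1 * (Δ v) y 1 ≤ K * cylRadius y ^ 2)
    (hgate : ∀ y : EuclideanSpace ℝ (Fin 3), cylRadius y = ρ → -c ≤ y 0 * v y 0 + y 1 * v y 1)
    {x : EuclideanSpace ℝ (Fin 3)} (hx0 : 0 < cylRadius x) (hxρ : cylRadius x < ρ) :
    -(c * cylRadius x ^ 2 / ρ ^ 2) - K / 8 * (ρ ^ 4 - cylRadius x ^ 4) ≤ x 0 * v x 0 + x 1 * v x 1 := by
  have hv1 : Differentiable ℝ v := (hv.of_le one_le_two).differentiable one_ne_zero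
  have hB0 : 0 ≤ B := (norm_nonneg _).trans (hB 0)
  suffices key : ∀ ε : ℝ, 0 < ε →
      -(c * cylRadius x ^ 2 / ρ ^ 2) - K / 8 * (ρ ^ 4 - cylRadius x ^ 4)
        - ε * (3 * ρ * cylRadius x + ‖x‖ ^ 2) ≤ x 0 * v x 0 + x 1 * v x 1 by
    have hpos : 0 ≤ 3 * ρ * cylRadius x + ‖x‖ ^ 2 := by positivity
    refine le_of_forall_pos_lt_add fun η hη => ?_
    have h1 := key (η / (3 * ρ * cylRadius x + ‖x‖ ^ 2 + 1)) (by positivity)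
    have h2 : η / (3 * ρ * cylRadius x + ‖x‖ ^ 2 + 1) * (3 * ρ * cylRadius x + ‖x‖ ^ 2) < η := by
      rw [div_mul_eq_mul_div, div_lt_iff₀ (by positivity)]
      nlinarith
    linarith
  intro ε hε
  set g : ℝ → ℝ := fun σ => c / ρ ^ 2 * σ - K / 8 * σ ^ 2 + K * ρ ^ 4 / 8 - ε * σ with hg_def
  set g₁ : ℝ → ℝ := fun σ => c / ρ ^ 2 - K / 4 * σ - ε with hg₁_def
  have hgd : ∀ σ ∈ (univ : Set ℝ), HasDerivAt g (g₁ σ) σ := fun σ _ => by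
    have h : HasDerivAt g (c / ρ ^ 2 * 1 - K / 8 * (2 * σ) + 0 - ε * 1) σ := by
      have hsq : HasDerivAt (fun σ : ℝ => σ ^ 2) (2 * σ) σ := by simpa using hasDerivAt_pow 2 σ
      exact ((((hasDerivAt_id σ).const_mul _).sub (hsq.const_mul _)).add (hasDerivAt_const σ _)).sub
        ((hasDerivAt_id σ).const_mul _)
    refine h.congr_deriv ?_
    simp only [hg₁_def]
    ring
  have hg₁d : ∀ σ, HasDerivAt g₁ (-(K / 4)) σ := fun σ => by
    have h : HasDerivAt g₁ (0 - K / 4 * 1 - 0) σ :=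
      (((hasDerivAt_const σ _).sub ((hasDerivAt_id σ).const_mul _)).sub (hasDerivAt_const σ _))
    refine h.congr_deriv ?_
    ring
  set Φ : EuclideanSpace ℝ (Fin 3) → ℝ := fun y => y 0 * v y 0 + y 1 * v y 1 with hΦ_def
  set P : EuclideanSpace ℝ (Fin 3) → ℝ := fun y => g (cylRadius y ^ 2) with hP_def
  set W₁ : EuclideanSpace ℝ (Fin 3) → ℝ := fun y => 3 * ρ * cylRadius y with hW₁_def
  set W₂ : EuclideanSpace ℝ (Fin 3) → ℝ := fun y => ‖y‖ ^ 2 with hW₂_def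
  set G : EuclideanSpace ℝ (Fin 3) → ℝ := fun y => Φ y + P y + ε * W₁ y + ε * W₂ y with hG_def
  have hΦs : ContDiff ℝ 2 Φ := contDiff_radialMomentum hv
  have hgs : ContDiff ℝ 2 g := by
    simp only [hg_def]
    fun_prop
  have hPs : ContDiff ℝ 2 P := by
    have h : P = fun y => g (y 0 ^ 2 + y 1 ^ 2) := by
      funext y; simp only [hP_def, cylRadius_sq]
    rw [h]
    exact hgs.comp contDiff_sq_add_sq
  have hW₁s : ∀ y : EuclideanSpace ℝ (Fin 3), 0 < cylRadius y → ContDiffAt ℝ 2 W₁ y := fun y hy =>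
    contDiffAt_const.mul (contDiffAt_cylRadius hy.ne')
  have hW₂s : ContDiff ℝ 2 W₂ := contDiff_norm_sq ℝ
  have hGc : Continuous G := by
    have h1 : Continuous Φ := hΦs.continuous
    have h2 : Continuous P := hPs.continuous
    have h3 : Continuous W₁ := continuous_const.mul continuous_cylRadius
    have h4 : Continuous W₂ := hW₂s.continuous
    simp only [hG_def]
    fun_prop
  have hG2 : ∀ y : EuclideanSpace ℝ (Fin 3), 0 < cylRadius y → ContDiffAt ℝ 2 G y := fun y hy => by
    simp only [hG_def]
    exact ((hΦs.contDiffAt.add hPs.contDiffAt).add (contDiffAt_const.mul (hW₁s y hy))).add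
      (contDiffAt_const.mul hW₂s.contDiffAt)
  have hDΦ : ∀ y : EuclideanSpace ℝ (Fin 3),
      fderiv ℝ Φ y (toLp 2 ![y 0, y 1, 0]) = cylRadius y ^ 2 *
        (fderiv ℝ v y (EuclideanSpace.single 0 1) 0 + fderiv ℝ v y (EuclideanSpace.single 1 1) 1) :=
    fun y => fderiv_radialMomentum_horizontal_of_isAxisymmetric hax (hv1 y)
  have hΔΦ : ∀ y : EuclideanSpace ℝ (Fin 3), (Δ Φ) y = (y 0 * (Δ v) y 0 + y 1 * (Δ v) y 1) +
      2 * (fderiv ℝ v y (EuclideanSpace.single 0 1) 0 + fderiv ℝ v y (EuclideanSpace.single 1 1) 1) :=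
    fun y => laplacian_radialMomentum hv y
  have hx0c : ∀ y : EuclideanSpace ℝ (Fin 3), (toLp 2 ![y 0, y 1, 0] : EuclideanSpace ℝ (Fin 3)) 0 = y 0 :=
    fun y => by simp
  have hx1c : ∀ y : EuclideanSpace ℝ (Fin 3), (toLp 2 ![y 0, y 1, 0] : EuclideanSpace ℝ (Fin 3)) 1 = y 1 :=
    fun y => by simp
  have hhf : ∀ y : EuclideanSpace ℝ (Fin 3), hform y (toLp 2 ![y 0, y 1, 0]) = 2 * cylRadius y ^ 2 := fun y => by
    rw [hform_apply, hx0c, hx1c, cylRadius_sq]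
    ring
  have hDP : ∀ y : EuclideanSpace ℝ (Fin 3),
      fderiv ℝ P y (toLp 2 ![y 0, y 1, 0]) = g₁ (cylRadius y ^ 2) * (2 * cylRadius y ^ 2) := fun y => by
    rw [hP_def, fderiv_comp_cylSq_apply (hgd _ (mem_univ _)), hhf]
  have hΔP : ∀ y : EuclideanSpace ℝ (Fin 3),
      (Δ P) y = 4 * (-(K / 4)) * cylRadius y ^ 2 + 4 * g₁ (cylRadius y ^ 2) := fun y => by
    rw [hP_def]
    exact laplacian_comp_cylSq isOpen_univ hgd (mem_univ _) (hg₁d _)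
  have hW₁calc : ∀ y : EuclideanSpace ℝ (Fin 3), 0 < cylRadius y → cylRadius y < ρ + 1 →
      fderiv ℝ W₁ y (toLp 2 ![y 0, y 1, 0]) = 3 * ρ * cylRadius y ∧
      (Δ W₁) y = 3 * ρ * (cylRadius y)⁻¹ := fun y hy hy1 => by
    have hφ : ContDiffOn ℝ 2 (fun s : ℝ => 3 * ρ * s) (Ioo 0 (ρ + 1)) := by fun_prop
    obtain ⟨-, hD, hL⟩ := barrier_slice_calculus hφ hy hy1
    have hd1 : deriv (fun s : ℝ => 3 * ρ * s) (cylRadius y) = 3 * ρ := by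
      rw [deriv_const_mul _ differentiableAt_id, deriv_id'']; ring
    have hd2 : iteratedDeriv 2 (fun s : ℝ => 3 * ρ * s) (cylRadius y) = 0 := by
      rw [iteratedDeriv_succ, iteratedDeriv_one]
      have : deriv (fun s : ℝ => 3 * ρ * s) = fun _ => 3 * ρ := by
        funext s; rw [deriv_const_mul _ differentiableAt_id, deriv_id'']; ring
      rw [this, deriv_const]
    refine ⟨?_, ?_⟩
    · rw [show W₁ = fun w => (fun s : ℝ => 3 * ρ * s) (cylRadius w) from rfl, hD, hd1, hx0c, hx1c,
        show y 0 * y 0 + y 1 * y 1 = cylRadius y ^ 2 by rw [cylRadius_sq]; ring]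
      field_simp
    · rw [show W₁ = fun w => (fun s : ℝ => 3 * ρ * s) (cylRadius w) from rfl, hL, hd1, hd2]
      ring
  have hDW₂ : ∀ y : EuclideanSpace ℝ (Fin 3), fderiv ℝ W₂ y (toLp 2 ![y 0, y 1, 0]) = 2 * cylRadius y ^ 2 :=
    fun y => by
    rw [hW₂_def, ((hasStrictFDerivAt_norm_sq y).hasFDerivAt).fderiv, _root_.smul_apply,
      innerSL_apply_apply, cylRadius_sq]
    simp only [PiLp.inner_apply, RCLike.inner_apply, conj_trivial, Fin.sum_univ_three,
      nsmul_eq_mul, Nat.cast_ofNat, Matrix.cons_val_zero, Matrix.cons_val_one,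
      Matrix.cons_val_two, Matrix.head_cons, Matrix.tail_cons]
    ring
  have hΔW₂ : ∀ y : EuclideanSpace ℝ (Fin 3), (Δ W₂) y = 6 := fun y => by
    rw [hW₂_def, Literature.Analysis.PDE.PoissonBall.laplacian_norm_sq]
    simp
    norm_num
  have hDG : ∀ y : EuclideanSpace ℝ (Fin 3), 0 < cylRadius y → cylRadius y < ρ →
      fderiv ℝ G y (toLp 2 ![y 0, y 1, 0]) =
        cylRadius y ^ 2 * (fderiv ℝ v y (EuclideanSpace.single 0 1) 0 + fderiv ℝ v y (EuclideanSpace.single 1 1) 1)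
        + g₁ (cylRadius y ^ 2) * (2 * cylRadius y ^ 2) + ε * (3 * ρ * cylRadius y) + ε * (2 * cylRadius y ^ 2) :=
    fun y hy hyρ => by
    have h1 : DifferentiableAt ℝ Φ y := hΦs.contDiffAt.differentiableAt (by simp)
    have h2 : DifferentiableAt ℝ P y := hPs.contDiffAt.differentiableAt (by simp)
    have h3 : DifferentiableAt ℝ W₁ y := (hW₁s y hy).differentiableAt (by simp)
    have h4 : DifferentiableAt ℝ W₂ y := hW₂s.contDiffAt.differentiableAt (by simp)
    have hGd : HasFDerivAt G
        (fderiv ℝ Φ y + fderiv ℝ P y + ε • fderiv ℝ W₁ y + ε • fderiv ℝ W₂ y) y :=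
      ((h1.hasFDerivAt.add h2.hasFDerivAt).add (h3.hasFDerivAt.const_mul ε)).add
        (h4.hasFDerivAt.const_mul ε)
    rw [hGd.fderiv]
    simp only [_root_.add_apply, _root_.smul_apply, smul_eq_mul]
    rw [hDΦ y, hDP y, (hW₁calc y hy (by linarith)).1, hDW₂ y]
  have hΔG : ∀ y : EuclideanSpace ℝ (Fin 3), 0 < cylRadius y → cylRadius y < ρ →
      (Δ G) y = (y 0 * (Δ v) y 0 + y 1 * (Δ v) y 1)
        + 2 * (fderiv ℝ v y (EuclideanSpace.single 0 1) 0 + fderiv ℝ v y (EuclideanSpace.single 1 1) 1)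
        + (4 * (-(K / 4)) * cylRadius y ^ 2 + 4 * g₁ (cylRadius y ^ 2))
        + ε * (3 * ρ * (cylRadius y)⁻¹) + ε * 6 := fun y hy hyρ => by
    have h1 : ContDiffAt ℝ 2 Φ y := hΦs.contDiffAt
    have h2 : ContDiffAt ℝ 2 P y := hPs.contDiffAt
    have h3 : ContDiffAt ℝ 2 (fun z => ε * W₁ z) y := contDiffAt_const.mul (hW₁s y hy)
    have h4 : ContDiffAt ℝ 2 (fun z => ε * W₂ z) y := contDiffAt_const.mul hW₂s.contDiffAt
    have h12 : ContDiffAt ℝ 2 (Φ + P) y := h1.add h2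
    have h123 : ContDiffAt ℝ 2 ((Φ + P) + fun z => ε * W₁ z) y := h12.add h3
    have e1 : G = ((Φ + P) + fun z => ε * W₁ z) + fun z => ε * W₂ z := by
      funext z; simp [hG_def]
    rw [e1, h123.laplacian_add h4, h12.laplacian_add h3, h1.laplacian_add h2]
    have e3 : (Δ (fun z => ε * W₁ z)) y = ε * (Δ W₁) y := by
      rw [show (fun z => ε * W₁ z) = ε • W₁ from rfl, InnerProductSpace.laplacian_smul ε (hW₁s y hy)]
      rfl
    have e4 : (Δ (fun z => ε * W₂ z)) y = ε * (Δ W₂) y := by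
      rw [show (fun z => ε * W₂ z) = ε • W₂ from rfl, InnerProductSpace.laplacian_smul ε hW₂s.contDiffAt]
      rfl
    rw [e3, e4, hΔΦ y, hΔP y, (hW₁calc y hy (by linarith)).2, hΔW₂ y]
  have hεne : ε ≠ 0 := hε.ne'
  set Z : ℝ := ρ + ρ * B / ε + |x 2| + 1 with hZ_def
  have hρBε : 0 ≤ ρ * B / ε := by positivity
  have hZx : |x 2| < Z := by simp only [hZ_def]; linarith
  have hZ : ρ * B + ε * ρ ^ 2 ≤ ε * Z ^ 2 := by
    have h1 : ρ * B + ε ≤ ε * (Z - ρ) := by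
      have e : ε * (Z - ρ) = ρ * B + ε * |x 2| + ε := by
        simp only [hZ_def]
        field_simp
        ring
      rw [e]
      nlinarith [abs_nonneg (x 2)]
    have h2 : 1 ≤ Z + ρ := by simp only [hZ_def]; linarith [abs_nonneg (x 2)]
    have h3 : (ρ * B + ε) * 1 ≤ (ε * (Z - ρ)) * (Z + ρ) :=
      mul_le_mul h1 h2 zero_le_one (by nlinarith)
    nlinarith [h3]
  have hmain := tube_min_principle (G := G) (ρ := ρ) (Z := Z) hGc
    (fun y hy hyρ _ => hG2 y hy) ?_ ?_ ?_ ?_ x hxρ.le hZx.le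
  · -- unpack `G x ≥ 0`
    have e : G x = (x 0 * v x 0 + x 1 * v x 1) + g (cylRadius x ^ 2) +
        ε * (3 * ρ * cylRadius x) + ε * ‖x‖ ^ 2 := by simp [hG_def, hΦ_def, hP_def, hW₁_def, hW₂_def]
    rw [e] at hmain
    have eg : g (cylRadius x ^ 2) = c / ρ ^ 2 * cylRadius x ^ 2 - K / 8 * (cylRadius x ^ 2) ^ 2
        + K * ρ ^ 4 / 8 - ε * cylRadius x ^ 2 := by simp [hg_def]
    rw [eg] at hmain
    have hε2 : 0 ≤ ε * cylRadius x ^ 2 := by positivity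
    have e2 : c * cylRadius x ^ 2 / ρ ^ 2 = c / ρ ^ 2 * cylRadius x ^ 2 := by ring
    linarith [hmain, hε2]
  · -- strict sign of `ΔG` at interior critical points
    intro y hy hyρ _ hcrit
    have hs : fderiv ℝ G y (toLp 2 ![y 0, y 1, 0]) = 0 := by rw [hcrit]; rfl
    rw [hDG y hy hyρ] at hs
    rw [hΔG y hy hyρ]
    have hr2 : 0 < cylRadius y ^ 2 := by positivity
    have hdiv : fderiv ℝ v y (EuclideanSpace.single 0 1) 0 + fderiv ℝ v y (EuclideanSpace.single 1 1) 1 =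
        -(2 * g₁ (cylRadius y ^ 2)) - ε * (3 * ρ) * (cylRadius y)⁻¹ - 2 * ε := by
      have hne : cylRadius y ≠ 0 := hy.ne'
      have h1 : fderiv ℝ v y (EuclideanSpace.single 0 1) 0 + fderiv ℝ v y (EuclideanSpace.single 1 1) 1 =
          (-(2 * g₁ (cylRadius y ^ 2) * cylRadius y ^ 2) - ε * (3 * ρ * cylRadius y)
            - ε * (2 * cylRadius y ^ 2)) / cylRadius y ^ 2 := by
        rw [eq_div_iff hr2.ne']
        linarith
      rw [h1]
      field_simp
    rw [hdiv]
    have hL := hlap y hy hyρ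
    have hinv : 1 < ρ * (cylRadius y)⁻¹ := by
      rw [← div_eq_mul_inv, lt_div_iff₀ hy]; linarith
    have h7 : ε * 1 < ε * (ρ * (cylRadius y)⁻¹) := mul_lt_mul_of_pos_left hinv hε
    simp only [hg₁_def]
    nlinarith [hL, h7]
  · -- the axis: `Φ = 0`, `g(0) = Kρ⁴/8 ≥ 0`, barrier `≥ 0`
    intro y hy _
    have h0 := (cylRadius_eq_zero_iff y).1 hy
    have e : G y = g 0 + ε * ‖y‖ ^ 2 := by
      simp [hG_def, hΦ_def, hP_def, hW₁_def, hW₂_def, hy, h0.1, h0.2]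
    rw [e]
    have : g 0 = K * ρ ^ 4 / 8 := by simp [hg_def]
    rw [this]
    positivity
  · -- the lateral boundary `r = ρ`: the gate
    intro y hy _
    have h1 := hgate y hy
    have e : G y = (y 0 * v y 0 + y 1 * v y 1) + g (ρ ^ 2) + ε * (3 * ρ * ρ) + ε * ‖y‖ ^ 2 := by
      simp [hG_def, hΦ_def, hP_def, hW₁_def, hW₂_def, hy]
    rw [e]
    have eg : g (ρ ^ 2) = c - ε * ρ ^ 2 := by
      simp only [hg_def]
      field_simp
      ring
    rw [eg]
    have hp1 : 0 ≤ ε * ‖y‖ ^ 2 := by positivity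
    have hp2 : 0 ≤ ε * ρ ^ 2 := by positivity
    linarith
  · -- the lids `|y₂| = Z`: the slice bound `Φ ≥ -ρ B` against `ε Z²`
    intro y hyρ hyZ
    have h1 := neg_cylRadius_mul_norm_le_radialMomentum y (v y)
    have h2 : cylRadius y * ‖v y‖ ≤ ρ * B :=
      mul_le_mul hyρ (hB y) (norm_nonneg _) hρ.le
    have e : G y = (y 0 * v y 0 + y 1 * v y 1) + g (cylRadius y ^ 2) +
        ε * (3 * ρ * cylRadius y) + ε * ‖y‖ ^ 2 := by simp [hG_def, hΦ_def, hP_def, hW₁_def, hW₂_def]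
    rw [e]
    have eg : g (cylRadius y ^ 2) = c / ρ ^ 2 * cylRadius y ^ 2 - K / 8 * (cylRadius y ^ 2) ^ 2
        + K * ρ ^ 4 / 8 - ε * cylRadius y ^ 2 := by simp [hg_def]
    rw [eg]
    have h3 : Z ^ 2 ≤ ‖y‖ ^ 2 := by
      have e1 := SwirlHolderTower.norm_sq_eq_cylRadius_sq_add y
      have e2 : y 2 ^ 2 = Z ^ 2 := by rw [← sq_abs, hyZ]
      have e3 : 0 ≤ cylRadius y ^ 2 := sq_nonneg _
      linarith
    have hr2le : cylRadius y ^ 2 ≤ ρ ^ 2 := pow_le_pow_left₀ (cylRadius_nonneg y) hyρ 2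
    have h4 : (cylRadius y ^ 2) ^ 2 ≤ (ρ ^ 2) ^ 2 := pow_le_pow_left₀ (sq_nonneg _) hr2le 2
    have h4' : K / 8 * (cylRadius y ^ 2) ^ 2 ≤ K / 8 * (ρ ^ 2) ^ 2 :=
      mul_le_mul_of_nonneg_left h4 (by positivity)
    have h4'' : K / 8 * (ρ ^ 2) ^ 2 = K * ρ ^ 4 / 8 := by ring
    have h5 : ε * cylRadius y ^ 2 ≤ ε * ρ ^ 2 := mul_le_mul_of_nonneg_left hr2le hε.le
    have h6 : 0 ≤ c / ρ ^ 2 * cylRadius y ^ 2 := by positivity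
    have h7 : 0 ≤ ε * (3 * ρ * cylRadius y) :=
      mul_nonneg hε.le (mul_nonneg (by positivity) (cylRadius_nonneg y))
    have h8 : ε * Z ^ 2 ≤ ε * ‖y‖ ^ 2 := mul_le_mul_of_nonneg_left h3 hε.le
    linarith [h1, h2, h4', h4'', h5, h6, h7, h8, hZ]

end Summit.NavierStokesRegularity.NavierStokesRegularity.Theorems.RadialInflowEllipticGate

end
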